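import Mathlib
import HarnessLib

/-!
# Non-square descent — A NON-TORSION ELEMENT MOD `ϖ` FROM A RANK-ONE LATTICE (the hypothesis `hw` of the S3 (c) certificate, DERIVED)
# for the seed crux `SignedMuSeedAtTwoPlus` stmt-BirchSwinnertonDyer-21438 (parent Kμ⁺ `SignedMuVanishingAtTwoPlus`
# stmt-BirchSwinnertonDyer-20689, route ResidualThetaTransportAtTwo), line card `Cruxes/SignedMuSeedAtTwoPlus/Lines/nonsquare-descent.md`

Cell `bsd-wall`, width seat `bsd-wall-rtt-p4-w2` g18 (`--supports`, closes nothing).  THEOREMS ONLY; BSD is not proved by this and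
nothing arithmetic is asserted: module algebra over a commutative domain.

The S3 (c) certificate `…NonsquareDescent.isTorsion_quotient_iff_exists_proj_ne_zero` (g17) and `isTorsion_quotient_span_iff` take as
INPUT a non-torsion element of `V_∞ = Ē^χ/2` over `𝔽₄⟦T⟧` (`hw : ∀ b ≠ 0, b • w ≠ 0`), which the line card (stub S3 (c): «`Ē` is
`ℤ₂`-torsion-free, so `V_∞ ≅ 𝔽₄⟦T⟧ ⊕ finite`») reads off the structure of `Ē^χ`.  This file DERIVES `hw` from the intrinsic datum
«`Ē^χ` is a non-zero lattice of rank one», i.e. an `R`-linear embedding `ι : E ↪ R` into the domain `R = Λ'`, for a PRIME `ϖ` of finite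
multiplicity in every non-zero element: **the reduction of an element of minimal `ϖ`-multiplicity is non-torsion mod `ϖ`.**
Dictionary: `R = Λ' = 𝒪⟦T⟧`, `ϖ = 2` (prime in `𝒪⟦T⟧` since `𝒪/2 = 𝔽₄` is a field), `E = Ē^χ`, `V = Ē^χ/2`, `q` the quotient map,
`S = 𝔽₄⟦T⟧`, `φ : Λ' → S` the reduction.

* §1 `finiteMultiplicity_iff_exists_not_pow_dvd` — the finite-multiplicity hypothesis in the form used by
  `Theorems/…NonsquareDescentRankOneModP.lean` (`∃ n, ¬ ϖⁿ ∣ a`).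
* §2 `exists_emultiplicity_eq_and_forall_le` — a non-zero lattice has an element whose image has MINIMAL `ϖ`-multiplicity.
* §3 **`smul_ne_zero_of_emultiplicity_minimal`** — if `ι w₀` has minimal `ϖ`-multiplicity `m` and `q : E → V` kills only multiples of `ϖ`,
  then `c • q w₀ ≠ 0` for every `c` with `ϖ ∤ c` (else `c w₀ = ϖ y`, and `m = mult(c·ι w₀) = 1 + mult(ι y) ≥ 1 + m`);
  **`exists_nonTorsion_modP`** (scalar form over `R`) and **`exists_nonTorsion_modP_of_ringHom`** — read through a surjective ring map
  `φ : R → S` with `φ r = 0 ↔ ϖ ∣ r` and a compatible `S`-structure on `V`: `∃ w : V, ∀ b : S, b ≠ 0 → b • w ≠ 0`, LITERALLY the input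
  `hw`; `exists_nonTorsion_mkQ_of_ringHom` — the instance `q = mkQ (ϖ • ⊤)`.

[folklore]
-/

set_option autoImplicit false
-- the Theorems namespace of this sub repeats the summit name by design (D-0017 nested layout)
set_option linter.dupNamespace false

open scoped Pointwise

namespace Summit.BirchSwinnertonDyer.BirchSwinnertonDyer.Theorems.SignedMuAtTwo.NonsquareDescent

/-! ## §1 Finite multiplicity, two spellings -/

section Finite

variable {R : Type*} [CommRing R]

/-- `FiniteMultiplicity ϖ a` (Mathlib: `∃ n, ¬ ϖⁿ⁺¹ ∣ a`) iff `∃ n, ¬ ϖⁿ ∣ a` (the spelling of `rank_le_one_modP`). [folklore] -/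
theorem finiteMultiplicity_iff_exists_not_pow_dvd (ϖ a : R) :
    FiniteMultiplicity ϖ a ↔ ∃ n : ℕ, ¬ ϖ ^ n ∣ a := by
  constructor
  · rintro ⟨n, hn⟩
    exact ⟨n + 1, hn⟩
  · rintro ⟨n, hn⟩
    rcases n with _ | n
    · exact absurd (by rw [pow_zero]; exact one_dvd a) hn
    · exact ⟨n, hn⟩

end Finite

/-! ## §2 An element of minimal `ϖ`-multiplicity -/

section Minimal

variable {R : Type*} [CommRing R] {E : Type*} [AddCommGroup E] [Module R E]

/-- A lattice `ι : E → R` with a non-zero image value, in a ring where non-zero elements have finite `ϖ`-multiplicity, has an element `w`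
with `ι w ≠ 0` of MINIMAL `ϖ`-multiplicity `m` among all non-zero image values. [folklore] -/
theorem exists_emultiplicity_eq_and_forall_le (ι : E →ₗ[R] R) (ϖ : R)
    (hfin : ∀ a : R, a ≠ 0 → FiniteMultiplicity ϖ a) {e₀ : E} (he₀ : ι e₀ ≠ 0) :
    ∃ (w : E) (m : ℕ), ι w ≠ 0 ∧ emultiplicity ϖ (ι w) = m ∧
      ∀ e : E, ι e ≠ 0 → (m : ℕ∞) ≤ emultiplicity ϖ (ι e) := by
  classical
  have hex : ∃ n : ℕ, ∃ e : E, ι e ≠ 0 ∧ emultiplicity ϖ (ι e) = n :=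
    ⟨multiplicity ϖ (ι e₀), e₀, he₀, (hfin _ he₀).emultiplicity_eq_multiplicity⟩
  obtain ⟨w, hw, hwm⟩ := Nat.find_spec hex
  refine ⟨w, Nat.find hex, hw, hwm, fun e he => ?_⟩
  rw [(hfin _ he).emultiplicity_eq_multiplicity, Nat.cast_le]
  exact Nat.find_min' hex ⟨e, he, (hfin _ he).emultiplicity_eq_multiplicity⟩

end Minimal

/-! ## §3 The reduction of a minimal-multiplicity element is non-torsion -/

section NonTorsion

variable {R : Type*} [CommRing R] [IsDomain R] {E : Type*} [AddCommGroup E] [Module R E]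
  {V : Type*} [AddCommGroup V] [Module R V]

/-- **Minimal `ϖ`-multiplicity ⇒ non-torsion mod `ϖ`.**  `R` a domain, `ϖ` prime with finite multiplicity in non-zero elements,
`ι : E → R` an `R`-linear map, `w₀ ∈ E` with `ι w₀ ≠ 0` of minimal `ϖ`-multiplicity `m`, and `q : E → V` an `R`-linear map whose
kernel consists of multiples of `ϖ` (`q e = 0 → e = ϖ • y`).  Then `c • q w₀ ≠ 0` whenever `ϖ ∤ c`: otherwise `c • w₀ = ϖ • y`, `y ≠ 0`, and
`m = mult_ϖ(c·ι w₀) = 1 + mult_ϖ(ι y) ≥ 1 + m`. [folklore] -/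
theorem smul_ne_zero_of_emultiplicity_minimal {ϖ : R} (hϖ : Prime ϖ)
    (hfin : ∀ a : R, a ≠ 0 → FiniteMultiplicity ϖ a)
    (ι : E →ₗ[R] R)
    {w₀ : E} {m : ℕ} (hw₀ : ι w₀ ≠ 0) (hm : emultiplicity ϖ (ι w₀) = m)
    (hmin : ∀ e : E, ι e ≠ 0 → (m : ℕ∞) ≤ emultiplicity ϖ (ι e))
    (q : E →ₗ[R] V) (hker : ∀ e : E, q e = 0 → ∃ y : E, e = ϖ • y)
    {c : R} (hc : ¬ ϖ ∣ c) : c • q w₀ ≠ 0 := by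
  intro h
  rw [← map_smul] at h
  obtain ⟨y, hy⟩ := hker _ h
  have hιeq : c * ι w₀ = ϖ * ι y := by rw [← smul_eq_mul, ← smul_eq_mul, ← map_smul, ← map_smul, hy]
  by_cases hy0 : ι y = 0
  · -- then `c • w₀ = 0` with `c ≠ 0`, so `ι w₀ = 0`
    rw [hy0, mul_zero] at hιeq
    have hc0 : c ≠ 0 := fun h0 => hc (h0 ▸ dvd_zero ϖ)
    rcases mul_eq_zero.mp hιeq with h1 | h1
    · exact hc0 h1
    · exact hw₀ h1
  · -- compare multiplicities
    have h1 : emultiplicity ϖ (c * ι w₀) = m := by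
      rw [emultiplicity_mul hϖ, emultiplicity_eq_zero.mpr hc, zero_add, hm]
    have h2 : emultiplicity ϖ (ϖ * ι y) = 1 + emultiplicity ϖ (ι y) := by
      rw [emultiplicity_mul hϖ, (hfin ϖ hϖ.ne_zero).emultiplicity_self]
    have h3 := hmin y hy0
    rw [hιeq, h2, (hfin _ hy0).emultiplicity_eq_multiplicity] at h1
    rw [(hfin _ hy0).emultiplicity_eq_multiplicity] at h3
    have h4 : ((1 + multiplicity ϖ (ι y) : ℕ) : ℕ∞) = (m : ℕ∞) := by push_cast; exact h1
    have h5 : 1 + multiplicity ϖ (ι y) = m := by exact_mod_cast h4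
    have h6 : m ≤ multiplicity ϖ (ι y) := by exact_mod_cast h3
    omega

/-- **A non-zero rank-one lattice has a non-torsion element mod `ϖ` (scalar form over `R`).**  With `ι : E ↪ R` injective into the domain
`R`, `E ∋ e₀ ≠ 0`, `ϖ` prime of finite multiplicity in non-zero elements, and `q : E → V` `R`-linear killing only multiples of `ϖ`:
`∃ w : V, ∀ c, ϖ ∤ c → c • w ≠ 0`. [folklore] -/
theorem exists_nonTorsion_modP {ϖ : R} (hϖ : Prime ϖ)
    (hfin : ∀ a : R, a ≠ 0 → FiniteMultiplicity ϖ a)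
    (ι : E →ₗ[R] R) (hι : Function.Injective ι) {e₀ : E} (he₀ : e₀ ≠ 0)
    (q : E →ₗ[R] V) (hker : ∀ e : E, q e = 0 → ∃ y : E, e = ϖ • y) :
    ∃ w : V, ∀ c : R, ¬ ϖ ∣ c → c • w ≠ 0 := by
  have hιe₀ : ι e₀ ≠ 0 := fun h0 => he₀ (hι (by rw [h0, map_zero]))
  obtain ⟨w₀, m, hw₀, hm, hmin⟩ := exists_emultiplicity_eq_and_forall_le ι ϖ hfin hιe₀
  exact ⟨q w₀, fun c hc => smul_ne_zero_of_emultiplicity_minimal hϖ hfin ι hw₀ hm hmin q hker hc⟩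

variable {S : Type*} [CommRing S] [Module S V]

/-- **A non-zero rank-one lattice has a non-torsion element mod `ϖ` — the certificate's hypothesis `hw` over `S = R/ϖ`.**  Same hypotheses,
read through a SURJECTIVE ring map `φ : R →+* S` with `φ r = 0 ↔ ϖ ∣ r` (the reduction `Λ' → 𝔽₄⟦T⟧`) and an `S`-structure on `V`
compatible with the `R`-structure (`r • v = φ r • v`): `∃ w : V, ∀ b : S, b ≠ 0 → b • w ≠ 0`, LITERALLY the input `hw` of
`isTorsion_quotient_span_iff` / `isTorsion_quotient_iff_exists_proj_ne_zero`. [folklore] -/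
theorem exists_nonTorsion_modP_of_ringHom {ϖ : R} (hϖ : Prime ϖ)
    (hfin : ∀ a : R, a ≠ 0 → FiniteMultiplicity ϖ a)
    (ι : E →ₗ[R] R) (hι : Function.Injective ι) {e₀ : E} (he₀ : e₀ ≠ 0)
    (q : E →ₗ[R] V) (hker : ∀ e : E, q e = 0 → ∃ y : E, e = ϖ • y)
    (φ : R →+* S) (hφs : Function.Surjective φ) (hφ : ∀ r : R, φ r = 0 ↔ ϖ ∣ r)
    (hcompat : ∀ (r : R) (v : V), r • v = φ r • v) :
    ∃ w : V, ∀ b : S, b ≠ 0 → b • w ≠ 0 := by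
  obtain ⟨w, hw⟩ := exists_nonTorsion_modP hϖ hfin ι hι he₀ q hker
  refine ⟨w, fun b hb => ?_⟩
  obtain ⟨c, rfl⟩ := hφs b
  have hc : ¬ ϖ ∣ c := fun h => hb ((hφ c).mpr h)
  rw [← hcompat]
  exact hw c hc

omit [IsDomain R] in
/-- The kernel hypothesis for the actual quotient map `E → E ⧸ ϖE`: `mkQ e = 0 → e = ϖ • y`. [folklore] -/
theorem exists_eq_smul_of_mkQ_eq_zero (ϖ : R) (e : E)
    (h : (ϖ • (⊤ : Submodule R E)).mkQ e = 0) : ∃ y : E, e = ϖ • y := by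
  rw [Submodule.mkQ_apply, Submodule.Quotient.mk_eq_zero, Submodule.mem_smul_pointwise_iff_exists] at h
  obtain ⟨y, -, hy⟩ := h
  exact ⟨y, hy.symm⟩

/-- **`hw` for `V_∞ = Ē^χ ⧸ 2Ē^χ` itself**: with `q = mkQ (ϖ • ⊤)` and any compatible `S`-module structure on the quotient, a non-zero
rank-one lattice `E ↪ R` yields a non-torsion element of `E ⧸ ϖE` over `S`. [folklore] -/
theorem exists_nonTorsion_mkQ_of_ringHom {ϖ : R} (hϖ : Prime ϖ)
    (hfin : ∀ a : R, a ≠ 0 → FiniteMultiplicity ϖ a)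
    (ι : E →ₗ[R] R) (hι : Function.Injective ι) {e₀ : E} (he₀ : e₀ ≠ 0)
    [Module S (E ⧸ (ϖ • (⊤ : Submodule R E)))]
    (φ : R →+* S) (hφs : Function.Surjective φ) (hφ : ∀ r : R, φ r = 0 ↔ ϖ ∣ r)
    (hcompat : ∀ (r : R) (v : E ⧸ (ϖ • (⊤ : Submodule R E))), r • v = φ r • v) :
    ∃ w : E ⧸ (ϖ • (⊤ : Submodule R E)), ∀ b : S, b ≠ 0 → b • w ≠ 0 :=
  exists_nonTorsion_modP_of_ringHom hϖ hfin ι hι he₀ (ϖ • (⊤ : Submodule R E)).mkQ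
    (exists_eq_smul_of_mkQ_eq_zero ϖ) φ hφs hφ hcompat

end NonTorsion

end Summit.BirchSwinnertonDyer.BirchSwinnertonDyer.Theorems.SignedMuAtTwo.NonsquareDescent
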